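import Literature.NumberTheory.EllipticCurves.Kato2004.AdmissibleZetaClass
import Summits.BirchSwinnertonDyer.BirchSwinnertonDyer.Theorems.Rank2ObservatoryPadicAtlasR2A00
import Summits.BirchSwinnertonDyer.BirchSwinnertonDyer.Theorems.Rank2Observatory389a1RankTwo
import HarnessLib

/-!
# Route `DerivedKatoValuationDoor` — the `(389a1, 5)` RUNG CERTIFICATE of the crux `DerivedKatoDoor`
# (stmt-BirchSwinnertonDyer-23024; line `birth`, stub `stub_rung389a1_5`)

Helper file (`--supports stmt-BirchSwinnertonDyer-23024`); it closes nothing and BSD is not proved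
by it. HONEST FRAMING: the BC5 rung of the crux D-K₂ («no `p`-power multiple of an admissible Kato
zeta class `z₀ ∈ 𝐇¹_Γ(T_5 E)` of `E = 389a1` lies in `T²·𝐇¹`», `v_T(z₀) ≤ 1`) is CONDITIONAL:
everything the kernel can decide about the cell `(389a1, 5)` of the rank-2 `p`-adic atlas
(`Rank2ObservatoryPadicAtlasR2A00.c389a1`, kernel certificate `c389a1_ok`) is decided here, and the
three inputs the tree cannot supply today are carried as EXPLICIT hypotheses, exactly as the atlas
row `padicRow_of_mem_atlasR2A00` carries its symbol DATA:

* the SYMBOL DATA of the cell (the plus modular symbols of the newform of `389a1` at the 25-th and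
  5-th roots of unity ARE the tabulated integers over a `5`-adic unit `D`, and are `5`-integral) —
  hypotheses `hD`/`hint`/`htab` of the series, never dischargeable in the tree (no modular-symbol
  engine in Lean);
* `Loc_5(389a1)` — some integral global class has a Kummer localisation at `5` with NON-ZERO formal
  logarithm (print: the `5`-adic logarithm of the generator `(0,0)` is a non-zero element of `5ℤ_5`;
  the `p`-adic regulator of `389A` has unit leading digit at every good ordinary `p ≤ 47`,
  Mazur–Stein–Tate 2006 §4.3) — the tree has the predicate `Kato2004.HasLocPKummerLog` but no
  `5`-adic logarithm evaluator;
* the line's PRINT SANDWICH at `(389a1, 5)` («`ord_T L_5 ≤ 2` for the newform ∧ `Loc_5` ⇒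
  `v_T(z₀) ≤ 1` for every admissible `z₀`»: Kato's explicit reciprocity law Thm. 16.6 /
  Burns–Kurihara–Sano Lemma 6.12–6.14 `λ = v + ord_T Col(loc w)` with `Col(w) ∈ 𝓘` by Poitou–Tate),
  which is the line's stub `stub_sandwichFromDA` SPECIALISED to `(389a1, 5)` and taken here as the
  hypothesis `hSand` (this file does not prove, restate or land that stub).

What IS decided in the kernel (no hypothesis): `389a1 ∈ atlasR2A00`; the model
`[0,1,1,−2,0]` is elliptic and globally minimal; `5` is a good ORDINARY prime of `389a1`
(`#Ẽ(𝔽₅) = 9`, `a₅ = −3`); `2 ≤ rank_ℤ E(ℚ)` (`Curve389a1.two_le_mordellWeilRank_row`); and, GIVEN the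
symbol data of the cell, `[T²] L_5(E,T) ≠ 0`, i.e. `ord_T L_5(E, T) ≤ 2` — the D-A₂ half of the
sandwich at `(389a1, 5)` (`order_padicLFunction_le_two_of_cell`, from the level-`25` Riemann sum
`‖RS‖ > 5⁻²` certified by `c389a1_ok`). With `hPRS` (Schneider 1985 / BMS Thm. 1.7) and `hkato`
(Kato Thm. 17.4) the same cell gives the full row `rank = 2`, `ord_T L_5 = 2`, `Ш[5^∞]` finite,
Schneider non-degeneracy, `s_5 = 2` (`padicRow_389a1`), i.e. `(v, w) = (1, 1)` is the only cell of the
critic's `(w, v)` table compatible with the rung.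

Why this rung lies outside BSD's known regime: `389a1` has analytic rank `2` (no Gross–Zagier–
Kolyvagin), and the door prime `5` (good ordinary, `ρ̄_{E,5}` onto since `N = 389` is prime and
`5 ∤ v_389(Δ) = 1`, Serre 1972 §3.1) exercises exactly the route's lever (Kato 12.5(4) / BKS Prop. 4.5
contrapositive at `a = 2`).

References: [Kato2004Asterisque] Thm. 12.5 (4) (p. 222), Thm. 16.6 (p. 264), Thm. 17.4 (p. 273);
[BurnsKuriharaSano2019] arXiv:1910.07404, Prop. 4.5 (p. 16), Lemma 6.12–6.14 (p. 26);
[MazurTateTeitelbaum1986Invent] §I.10–I.13; [BalakrishnanMullerStein2015] Thm. 1.7;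
[CremonaAlgorithms1997] Table 1 (389A1); [Serre1972] §3.1 Prop. 21; Mazur–Stein–Tate,
«Computation of p-adic heights and log convergence» (2006) §4.3.
-/

set_option linter.dupNamespace false

noncomputable section

open scoped Classical

namespace Summit.BirchSwinnertonDyer.BirchSwinnertonDyer.Theorems.DerivedKatoValuationDoor

open Literature.NumberTheory.EllipticCurves Literature.NumberTheory.EllipticCurves.ModularForms
  Literature.NumberTheory.EllipticCurves.Kato2004 Literature.NumberTheory.GaloisRepresentations
  WeierstrassCurve CongruenceSubgroup
open Summit.BirchSwinnertonDyer.BirchSwinnertonDyer.Rank2Observatory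
open Literature.NumberTheory.EllipticCurves.Kato2004.EulerSystemValues (tateRep)

/-! ## §1 The cell `(389a1, 5)` of the atlas: what the kernel decides -/

/-- `389a1` is a curve of the atlas table `atlasR2A00` (its head). [cite: CremonaAlgorithms1997, Table 1 (389A1)] -/
theorem c389a1_mem_atlasR2A00 : c389a1 ∈ atlasR2A00 :=
  List.mem_cons_self

/-- The kernel test of `389a1` passes (`c389a1_ok`, first conjunct). [folklore] -/
theorem c389a1_check : c389a1.check = true :=
  (AtlasCurve.check_of_all atlasR2A00_check c389a1_mem_atlasR2A00).1

/-- `389a1 = [0,1,1,−2,0] ⊗ ℚ` is an elliptic curve (`Δ = 389 ≠ 0`). [folklore] -/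
theorem isElliptic_389a1 : (c389a1.e.baseChange ℚ).IsElliptic :=
  isElliptic_of_mem_atlasR2A00 c389a1_mem_atlasR2A00

/-- `[0,1,1,−2,0]` is a global minimal model of `389a1` (the atlas' finite criterion, `c389a1_ok`).
[cite: SilvermanAEC2009, VII.1 Remark 1.1] -/
theorem isGloballyMinimal_389a1 : (c389a1.e.baseChange ℚ).IsGloballyMinimal :=
  isGloballyMinimal_of_mem_atlasR2A00 c389a1_mem_atlasR2A00

/-- The cells of `389a1` are non-empty (there are four: `p = 5, 7, 11, 13`). [folklore] -/
theorem c389a1_cells_ne_nil : c389a1.cells ≠ [] := by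
  simp [c389a1]

/-- The head cell of `389a1` is the `p = 5` cell. [folklore] -/
theorem c389a1_cells_head_p : (c389a1.cells.head c389a1_cells_ne_nil).p = 5 := rfl

/-- The `p = 5` cell is a cell of `389a1`. [folklore] -/
theorem c389a1_cells_head_mem : c389a1.cells.head c389a1_cells_ne_nil ∈ c389a1.cells :=
  List.head_mem _

/-- **`5` is a good ORDINARY prime of `389a1`** (kernel: `5 ∤ Δ = 389`, `#Ẽ(𝔽₅) = 9 = 5 + 1 − a₅` with
`a₅ = −3`, `5 ∤ a₅`; `AtlasCell.isOrdinaryAt_of_check` on the `p = 5` cell).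
[cite: CremonaAlgorithms1997, Table 1 (389A1)] [cite: SilvermanAEC2009, VII.1 Remark 1.1] -/
theorem isOrdinaryAt_389a1_five [(c389a1.e.baseChange ℚ).IsGloballyMinimal] :
    IsOrdinaryAt (c389a1.e.baseChange ℚ) 5 := by
  haveI : Fact (c389a1.cells.head c389a1_cells_ne_nil).p.Prime :=
    ⟨AtlasCurve.prime_of_mem c389a1_check c389a1_cells_head_mem⟩
  exact AtlasCell.isOrdinaryAt_of_check (AtlasCurve.cell_check c389a1_check c389a1_cells_head_mem)

/-- **`2 ≤ rank_ℤ E(ℚ)` for `E = 389a1`, unconditionally** (the tree's kernel certificate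
`Curve389a1.two_le_mordellWeilRank_row`, transported along `AtlasCurve.baseChange_e`): the census rank
hypothesis `hlow` of the atlas row is discharged for this curve. [cite: CremonaAlgorithms1997, Table 1 (389A1)] -/
theorem two_le_mordellWeilRank_389a1 : 2 ≤ (c389a1.e.baseChange ℚ).mordellWeilRank := by
  rw [AtlasCurve.baseChange_e]
  exact Curve389a1.two_le_mordellWeilRank_row

/-! ## §2 The D-A₂ half at an atlas cell needs only the symbol DATA -/

/-- **`ord_T L_p(E, T) ≤ 2` at every cell of a checking atlas curve, from the symbol DATA alone.** For a
curve `C` of the atlas passing `AtlasCurve.check` and a cell `c ∈ C.cells` (`p = c.p`), and for every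
newform `f` of `C ⊗ ℚ` whose plus symbols are `p`-integral (`hint`) and whose symbols at the
`p^{n+1}`-th and `p^n`-th roots of unity are the tabulated integers over a `p`-adic unit `D` (`htab`,
`hD`): the kernel-checked level-`p^{n+1}` Riemann sum gives `[T²] L_p(f, α_p, T) ≠ 0`
(`coeff_ne_zero_of_symbolCertL`), hence `ord_{T=0} L_p ≤ 2`. No `hPRS`, no `hkato`, no rank input:
this is the ANALYTIC upper half (D-A₂) of the cell. [cite: MazurTateTeitelbaum1986Invent, §I.10–I.13]
[cite: SteinWuthrich2013, §3] -/
theorem order_padicLFunction_le_two_of_cell {C : AtlasCurve} (h : C.check = true) {c : AtlasCell}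
    (hc : c ∈ C.cells) [Fact c.p.Prime] [(C.e.baseChange ℚ).IsElliptic]
    [(C.e.baseChange ℚ).IsGloballyMinimal] {N : ℕ} [NeZero N] {f : CuspForm (Gamma0 N) 2}
    (hf : IsNewformOf (C.e.baseChange ℚ) f) (D : ℚ) (hD : ‖(D : ℚ_[c.p])‖ = 1)
    (hint : ∀ x : ℚ, ‖(ratPlusSymbol f x : ℚ_[c.p])‖ ≤ 1)
    (htab : ∀ u : ℕ, u < c.p ^ (c.n + 1) → ¬ c.p ∣ u →
      ratPlusSymbol f ((u : ℚ) / (c.p : ℚ) ^ (c.n + 1)) = (c.tabHi.getD u 0 : ℚ) / D ∧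
      ratPlusSymbol f ((u : ℚ) / (c.p : ℚ) ^ c.n) = (c.tabLo.getD (u % c.p ^ c.n) 0 : ℚ) / D) :
    (padicLFunction f (unitRoot (C.e.baseChange ℚ) c.p : ℚ_[c.p])).order ≤ 2 := by
  have hk : c.check C.e = true := AtlasCurve.cell_check h hc
  have htab' : ∀ u : ℕ, u < c.p ^ (c.certL.n + 1) → ¬ c.p ∣ u →
      ratPlusSymbol f ((u : ℚ) / (c.p : ℚ) ^ (c.certL.n + 1)) = (c.certL.tabHi.getD u 0 : ℚ) / D ∧
      ratPlusSymbol f ((u : ℚ) / (c.p : ℚ) ^ c.certL.n) = (c.certL.tabLo.getD u 0 : ℚ) / D :=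
    fun u hu hpu => by
      rw [AtlasCell.certL_tabLo_getD c hu]
      exact htab u hu hpu
  have hne := coeff_ne_zero_of_symbolCertL c.p (C.e.baseChange ℚ) (AtlasCell.isOrdinaryAt_of_check hk)
    hf (AtlasCell.frobeniusTrace_of_check hk) c.certL (AtlasCell.validL_of_check hk) D hD hint htab'
  exact PowerSeries.order_le 2 hne

/-- **D-A₂ at `(389a1, 5)`: `ord_T L_5(389a1, T) ≤ 2`** for every newform `f` of `389a1` carrying the
symbol DATA of the `p = 5` cell of `c389a1` (level `25`: `tabHi` = the 25 numerators of `D·[u/25]⁺`,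
`tabLo = [0,2,−2,−2,2]` those of `D·[v/5]⁺`, `‖D‖₅ = 1`, symbols `5`-integral). Kernel modulo DATA.
[cite: MazurTateTeitelbaum1986Invent, §I.10–I.13] [cite: SteinWuthrich2013, §3] -/
theorem order_padicLFunction_le_two_389a1_five [Fact (5 : ℕ).Prime] [(c389a1.e.baseChange ℚ).IsElliptic]
    [(c389a1.e.baseChange ℚ).IsGloballyMinimal] {N : ℕ} [NeZero N] {f : CuspForm (Gamma0 N) 2}
    (hf : IsNewformOf (c389a1.e.baseChange ℚ) f)
    (hdata : ∀ c ∈ c389a1.cells, c.p = 5 → ∃ D : ℚ, ‖(D : ℚ_[5])‖ = 1 ∧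
      (∀ x : ℚ, ‖(ratPlusSymbol f x : ℚ_[5])‖ ≤ 1) ∧
      ∀ u : ℕ, u < 5 ^ (c.n + 1) → ¬ 5 ∣ u →
        ratPlusSymbol f ((u : ℚ) / (5 : ℚ) ^ (c.n + 1)) = (c.tabHi.getD u 0 : ℚ) / D ∧
        ratPlusSymbol f ((u : ℚ) / (5 : ℚ) ^ c.n) = (c.tabLo.getD (u % 5 ^ c.n) 0 : ℚ) / D) :
    (padicLFunction f (unitRoot (c389a1.e.baseChange ℚ) 5 : ℚ_[5])).order ≤ 2 := by
  obtain ⟨D, hD, hint, htab⟩ := hdata _ c389a1_cells_head_mem c389a1_cells_head_p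
  haveI : Fact (c389a1.cells.head c389a1_cells_ne_nil).p.Prime := ‹Fact (Nat.Prime 5)›
  exact order_padicLFunction_le_two_of_cell c389a1_check c389a1_cells_head_mem
    (c := c389a1.cells.head c389a1_cells_ne_nil) hf D hD hint htab

/-! ## §3 The full `5`-adic row of `389a1` (the E-S0-1 atlas cell), census rank discharged -/

/-- **The `5`-adic row of `389a1`** — `padicRow_of_mem_atlasR2A00` at the cell `(389a1, 5)` with the
census rank certificate DISCHARGED by the kernel (`two_le_mordellWeilRank_389a1`): GIVEN `hPRS`
(Perrin-Riou–Schneider, BMS Thm. 1.7), `hkato` (Kato Thm. 17.4 for all cyclotomic data at `5`), the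
newform `hf` and the symbol DATA of the cell (`hdata`), one has `rank_ℤ E(ℚ) = 2`,
`ord_{T=0} L_5(E, T) = 2`, `Ш(E/ℚ)[5^∞]` finite, Schneider non-degeneracy of every canonical `5`-adic
height datum, and `corank Sel_{5^∞}(E/ℚ) = 2`. In the critic's `(w, v)` bookkeeping
(`ρ_5 = v + w = 2`) this is the cell where the rung below asserts `v = 1`.
[cite: BalakrishnanMullerStein2015, Thm. 1.7] [cite: Kato2004Asterisque, Thm. 17.4 (p. 273)]
[cite: MazurTateTeitelbaum1986Invent, §I.10–I.13] [cite: CremonaAlgorithms1997, Table 1 (389A1)] -/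
theorem padicRow_389a1_five [Fact (5 : ℕ).Prime] [(c389a1.e.baseChange ℚ).IsElliptic]
    [(c389a1.e.baseChange ℚ).IsGloballyMinimal] (hPRS : Schneider1985_order_charGenerator)
    {N : ℕ} [NeZero N] {f : CuspForm (Gamma0 N) 2} (hf : IsNewformOf (c389a1.e.baseChange ℚ) f)
    (hkato : ∀ (κ : ZpExtension ℚ 5) (γ : Field.absoluteGaloisGroup ℚ),
      kato_divisibility (c389a1.e.baseChange ℚ) 5 (κ := κ) (γ := γ) (f := f))
    (hdata : ∀ c ∈ c389a1.cells, c.p = 5 → ∃ D : ℚ, ‖(D : ℚ_[5])‖ = 1 ∧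
      (∀ x : ℚ, ‖(ratPlusSymbol f x : ℚ_[5])‖ ≤ 1) ∧
      ∀ u : ℕ, u < 5 ^ (c.n + 1) → ¬ 5 ∣ u →
        ratPlusSymbol f ((u : ℚ) / (5 : ℚ) ^ (c.n + 1)) = (c.tabHi.getD u 0 : ℚ) / D ∧
        ratPlusSymbol f ((u : ℚ) / (5 : ℚ) ^ c.n) = (c.tabLo.getD (u % 5 ^ c.n) 0 : ℚ) / D) :
    (c389a1.e.baseChange ℚ).mordellWeilRank = 2 ∧
      (padicLFunction f (unitRoot (c389a1.e.baseChange ℚ) 5 : ℚ_[5])).order = 2 ∧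
      Finite (AddCommGroup.primaryComponent (c389a1.e.baseChange ℚ).sha 5) ∧
      (∀ Dh : PAdicHeightData (c389a1.e.baseChange ℚ) 5, Dh.IsCanonical → SchneiderConjecture Dh) ∧
      (c389a1.e.baseChange ℚ).selmerCorank 5 = 2 := by
  obtain ⟨D, hD, hint, htab⟩ := hdata _ c389a1_cells_head_mem c389a1_cells_head_p
  haveI : Fact (c389a1.cells.head c389a1_cells_ne_nil).p.Prime := ‹Fact (Nat.Prime 5)›
  have h := padicRow_of_mem_atlasR2A00 c389a1_mem_atlasR2A00 c389a1_cells_head_mem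
    (c := c389a1.cells.head c389a1_cells_ne_nil) hPRS hf hkato Curve389a1.two_le_mordellWeilRank_row
    D hD hint htab
  rw [← AtlasCurve.baseChange_e] at h
  exact h

/-! ## §4 The rung, modulo the line's sandwich, `Loc_5` and the symbol DATA -/

/-- **The `(389a1, 5)` rung of D-K₂ (`DerivedKatoDoor`), CONDITIONAL** — the registered statement of
`stub_rung389a1_5` («at the door prime `5` of `E = 389a1`, for every cyclotomic `ℤ_5`-extension `K`,
topological generator `γ`, pinned Iwasawa cohomology `I = 𝐇¹_Γ(T_5E)` and every ADMISSIBLE Kato zeta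
class `z₀ ∈ I.H`: no `5^m • z₀` lies in `T² • I.H`», i.e. `v_T(z₀) ≤ 1`) under three explicit
hypotheses the tree cannot discharge today: `hSand`, the line's print sandwich SPECIALISED to
`(389a1, 5)` (door ⇒ (`ord_T L_5 ≤ 2` for every newform ∧ `Loc_5`) ⇒ `v_T ≤ 1`; Kato Thm. 16.6 +
Burns–Kurihara–Sano Lemma 6.12–6.14 + Poitou–Tate; = the line's `stub_sandwichFromDA` at `W = 389a1`,
`p = 5`, NOT proved here); `hLoc`, `Loc_5(389a1)` (a global integral class whose localisation at `5`
is a Kummer class of non-zero logarithm; print/numerics); and `hdata`, the symbol DATA of the atlas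
cell (as in `padicRow_of_mem_atlasR2A00`). The kernel supplies the rest: D-A₂ at `(389a1, 5)`
(`order_padicLFunction_le_two_389a1_five`). The door hypothesis is consumed by the sandwich; its first
two conjuncts are theorems (`5 ≤ 5`, `isOrdinaryAt_389a1_five`), the third (`ρ̄_{E,5}` onto) is
Serre 1972 §3.1 for the semistable curve of prime conductor `389` (cite only). BSD is not proved by
this; the crux D-K₂ is not proved by this (one cell, three hypotheses).
[cite: Kato2004Asterisque, Thm. 12.5 (4) (p. 222) and Thm. 16.6 (p. 264)]
[cite: BurnsKuriharaSano2019, Prop. 4.5 (p. 16) and Lemma 6.12–6.14 (p. 26)]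
[cite: MazurTateTeitelbaum1986Invent, §I.10–I.13] [cite: Serre1972, §3.1 Prop. 21] -/
theorem rung389a1_five_of_sandwich [Fact (5 : ℕ).Prime] [(c389a1.e.baseChange ℚ).IsElliptic]
    [(c389a1.e.baseChange ℚ).IsGloballyMinimal]
    [ContinuousSMul ℤ_[5] ((c389a1.e.baseChange ℚ).tateModule 5)]
    (hSand : (5 ≤ 5 ∧ IsOrdinaryAt (c389a1.e.baseChange ℚ) 5 ∧
        (c389a1.e.baseChange ℚ).HasSurjectiveModNGaloisRep 5) →
      ((∀ {N : ℕ} [NeZero N] (f : CuspForm (Gamma0 N) 2), IsNewformOf (c389a1.e.baseChange ℚ) f →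
          (padicLFunction f (unitRoot (c389a1.e.baseChange ℚ) 5 : ℚ_[5])).order ≤ 2) ∧
        (∃ (x : H1 (tateRep (c389a1.e.baseChange ℚ) 5) ⊤) (t : ℚ_[5]),
          x ∈ integralH1 (tateRep (c389a1.e.baseChange ℚ) 5) 5 ⊤ ∧ t ≠ 0 ∧
          HasLocPKummerLog (c389a1.e.baseChange ℚ) 5 x t)) →
      ∀ (K : ZpExtension ℚ 5) (hK : K.IsCyclotomic) (γ : Field.absoluteGaloisGroup ℚ)
        (I : IwasawaH1Data (c389a1.e.baseChange ℚ) 5 K γ) (z₀ : I.H), K.IsTopGenerator γ →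
        IsAdmissibleZetaClass (c389a1.e.baseChange ℚ) 5 K hK I z₀ →
        ¬ ∃ (h : I.H) (m : ℕ), ((5 : IwasawaAlgebra 5) ^ m) • z₀ =
          ((PowerSeries.X : IwasawaAlgebra 5) ^ 2) • h)
    (hLoc : ∃ (x : H1 (tateRep (c389a1.e.baseChange ℚ) 5) ⊤) (t : ℚ_[5]),
        x ∈ integralH1 (tateRep (c389a1.e.baseChange ℚ) 5) 5 ⊤ ∧ t ≠ 0 ∧
        HasLocPKummerLog (c389a1.e.baseChange ℚ) 5 x t)
    (hdata : ∀ c ∈ c389a1.cells, c.p = 5 → ∀ {N : ℕ} [NeZero N] (f : CuspForm (Gamma0 N) 2),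
      IsNewformOf (c389a1.e.baseChange ℚ) f → ∃ D : ℚ, ‖(D : ℚ_[5])‖ = 1 ∧
        (∀ x : ℚ, ‖(ratPlusSymbol f x : ℚ_[5])‖ ≤ 1) ∧
        ∀ u : ℕ, u < 5 ^ (c.n + 1) → ¬ 5 ∣ u →
          ratPlusSymbol f ((u : ℚ) / (5 : ℚ) ^ (c.n + 1)) = (c.tabHi.getD u 0 : ℚ) / D ∧
          ratPlusSymbol f ((u : ℚ) / (5 : ℚ) ^ c.n) = (c.tabLo.getD (u % 5 ^ c.n) 0 : ℚ) / D) :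
    (5 ≤ 5 ∧ IsOrdinaryAt (c389a1.e.baseChange ℚ) 5 ∧
        (c389a1.e.baseChange ℚ).HasSurjectiveModNGaloisRep 5) →
      ∀ (K : ZpExtension ℚ 5) (hK : K.IsCyclotomic) (γ : Field.absoluteGaloisGroup ℚ)
        (I : IwasawaH1Data (c389a1.e.baseChange ℚ) 5 K γ) (z₀ : I.H), K.IsTopGenerator γ →
        IsAdmissibleZetaClass (c389a1.e.baseChange ℚ) 5 K hK I z₀ →
        ¬ ∃ (h : I.H) (m : ℕ), ((5 : IwasawaAlgebra 5) ^ m) • z₀ =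
          ((PowerSeries.X : IwasawaAlgebra 5) ^ 2) • h := by
  intro hdoor
  exact hSand hdoor ⟨fun f hf => order_padicLFunction_le_two_389a1_five hf
    (fun c hc hp => hdata c hc hp f hf), hLoc⟩

/-- **The door hypothesis at `(389a1, 5)` reduces to surjectivity of `ρ̄_{E,5}`**: `5 ≤ 5` and good
ordinary reduction at `5` are kernel theorems, so the rung's antecedent is
`HasSurjectiveModNGaloisRep 5` alone (Serre 1972, §3.1: `N = 389` prime, `5 ∤ v_389(Δ_min) = 1`,
cite only). [cite: Serre1972, §3.1 Prop. 21] [cite: CremonaAlgorithms1997, Table 1 (389A1)] -/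
theorem door_389a1_five_of_surjective [(c389a1.e.baseChange ℚ).IsGloballyMinimal]
    (hsurj : (c389a1.e.baseChange ℚ).HasSurjectiveModNGaloisRep 5) :
    5 ≤ 5 ∧ IsOrdinaryAt (c389a1.e.baseChange ℚ) 5 ∧
      (c389a1.e.baseChange ℚ).HasSurjectiveModNGaloisRep 5 :=
  ⟨le_rfl, isOrdinaryAt_389a1_five, hsurj⟩

/-! ## §5 Appended: the rung through ONE newform (the L-b retype of the sandwich: the open stub
carries the newform existentially and the sandwich consumes that `f`) -/

/-- **The `(389a1, 5)` rung, per-newform form (CONDITIONAL)** — the same registered conclusion of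
`stub_rung389a1_5`, from: `hSand₁`, the line's sandwich at `(389a1, 5)` in the form that CONSUMES a
newform `f` («door ⇒ for every newform `f` of `389a1`: `ord_T L_5(f, α) ≤ 2` ⇒ `Loc_5` ⇒ `v_T(z₀) ≤ 1`
for every admissible `z₀`»; any typing of `stub_sandwichFromDA` — universal, existential-conjunctive
(critic V#20 L-b) or curried — yields it by logic alone; NOT proved here: Kato Thm. 16.6 + Poitou–Tate);
ONE newform `f` of `389a1` (`hf`; modularity — tree fact `ModularForms.exists_isNewformOf` — is where a
caller gets it) with the symbol DATA of the `p = 5` cell for THAT `f` (`hdata`, as in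
`padicRow_of_mem_atlasR2A00`); and `Loc_5(389a1)` (`hLoc`). Kernel content: `ord_T L_5 ≤ 2` for that
`f` (`order_padicLFunction_le_two_389a1_five`). BSD is not proved by this; the crux is not proved by
this. [cite: Kato2004Asterisque, Thm. 16.6 (p. 264)] [cite: BurnsKuriharaSano2019, Lemma 6.12–6.14 (p. 26)]
[cite: MazurTateTeitelbaum1986Invent, §I.10–I.13] -/
theorem rung389a1_five_of_sandwich_newform [Fact (5 : ℕ).Prime] [(c389a1.e.baseChange ℚ).IsElliptic]
    [(c389a1.e.baseChange ℚ).IsGloballyMinimal]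
    [ContinuousSMul ℤ_[5] ((c389a1.e.baseChange ℚ).tateModule 5)]
    (hSand₁ : (5 ≤ 5 ∧ IsOrdinaryAt (c389a1.e.baseChange ℚ) 5 ∧
        (c389a1.e.baseChange ℚ).HasSurjectiveModNGaloisRep 5) →
      ∀ {N : ℕ} [NeZero N] (f : CuspForm (Gamma0 N) 2), IsNewformOf (c389a1.e.baseChange ℚ) f →
        (padicLFunction f (unitRoot (c389a1.e.baseChange ℚ) 5 : ℚ_[5])).order ≤ 2 →
        (∃ (x : H1 (tateRep (c389a1.e.baseChange ℚ) 5) ⊤) (t : ℚ_[5]),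
          x ∈ integralH1 (tateRep (c389a1.e.baseChange ℚ) 5) 5 ⊤ ∧ t ≠ 0 ∧
          HasLocPKummerLog (c389a1.e.baseChange ℚ) 5 x t) →
      ∀ (K : ZpExtension ℚ 5) (hK : K.IsCyclotomic) (γ : Field.absoluteGaloisGroup ℚ)
        (I : IwasawaH1Data (c389a1.e.baseChange ℚ) 5 K γ) (z₀ : I.H), K.IsTopGenerator γ →
        IsAdmissibleZetaClass (c389a1.e.baseChange ℚ) 5 K hK I z₀ →
        ¬ ∃ (h : I.H) (m : ℕ), ((5 : IwasawaAlgebra 5) ^ m) • z₀ =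
          ((PowerSeries.X : IwasawaAlgebra 5) ^ 2) • h)
    {N : ℕ} [NeZero N] {f : CuspForm (Gamma0 N) 2} (hf : IsNewformOf (c389a1.e.baseChange ℚ) f)
    (hdata : ∀ c ∈ c389a1.cells, c.p = 5 → ∃ D : ℚ, ‖(D : ℚ_[5])‖ = 1 ∧
      (∀ x : ℚ, ‖(ratPlusSymbol f x : ℚ_[5])‖ ≤ 1) ∧
      ∀ u : ℕ, u < 5 ^ (c.n + 1) → ¬ 5 ∣ u →
        ratPlusSymbol f ((u : ℚ) / (5 : ℚ) ^ (c.n + 1)) = (c.tabHi.getD u 0 : ℚ) / D ∧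
        ratPlusSymbol f ((u : ℚ) / (5 : ℚ) ^ c.n) = (c.tabLo.getD (u % 5 ^ c.n) 0 : ℚ) / D)
    (hLoc : ∃ (x : H1 (tateRep (c389a1.e.baseChange ℚ) 5) ⊤) (t : ℚ_[5]),
        x ∈ integralH1 (tateRep (c389a1.e.baseChange ℚ) 5) 5 ⊤ ∧ t ≠ 0 ∧
        HasLocPKummerLog (c389a1.e.baseChange ℚ) 5 x t) :
    (5 ≤ 5 ∧ IsOrdinaryAt (c389a1.e.baseChange ℚ) 5 ∧
        (c389a1.e.baseChange ℚ).HasSurjectiveModNGaloisRep 5) →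
      ∀ (K : ZpExtension ℚ 5) (hK : K.IsCyclotomic) (γ : Field.absoluteGaloisGroup ℚ)
        (I : IwasawaH1Data (c389a1.e.baseChange ℚ) 5 K γ) (z₀ : I.H), K.IsTopGenerator γ →
        IsAdmissibleZetaClass (c389a1.e.baseChange ℚ) 5 K hK I z₀ →
        ¬ ∃ (h : I.H) (m : ℕ), ((5 : IwasawaAlgebra 5) ^ m) • z₀ =
          ((PowerSeries.X : IwasawaAlgebra 5) ^ 2) • h := by
  intro hdoor
  exact hSand₁ hdoor f hf (order_padicLFunction_le_two_389a1_five hf hdata) hLoc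

/-- **The universal sandwich yields the per-newform one** (logic only): a proof of the line's
`stub_sandwichFromDA` at `(389a1, 5)` in its birth (∀-newform) typing gives `hSand₁` of
`rung389a1_five_of_sandwich_newform` as soon as ONE newform with `ord_T L_5 ≤ 2` controls them all — which
is the case when the newform of `389a1` is unique (level = conductor `389`, multiplicity one; tree facts
`ModularForms.existsUnique_isNewformOf` / `IsNewformOf.level_eq_conductorNorm`, not used here). Recorded
in the weaker, hypothesis-explicit form: if every newform of `389a1` has `ord_T L_5 ≤ 2` (`hall`), the
universal sandwich applies. [folklore] -/
theorem sandwich_newform_of_sandwich_forall [Fact (5 : ℕ).Prime] [(c389a1.e.baseChange ℚ).IsElliptic]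
    [(c389a1.e.baseChange ℚ).IsGloballyMinimal]
    [ContinuousSMul ℤ_[5] ((c389a1.e.baseChange ℚ).tateModule 5)]
    (hSand : (5 ≤ 5 ∧ IsOrdinaryAt (c389a1.e.baseChange ℚ) 5 ∧
        (c389a1.e.baseChange ℚ).HasSurjectiveModNGaloisRep 5) →
      ((∀ {N : ℕ} [NeZero N] (f : CuspForm (Gamma0 N) 2), IsNewformOf (c389a1.e.baseChange ℚ) f →
          (padicLFunction f (unitRoot (c389a1.e.baseChange ℚ) 5 : ℚ_[5])).order ≤ 2) ∧
        (∃ (x : H1 (tateRep (c389a1.e.baseChange ℚ) 5) ⊤) (t : ℚ_[5]),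
          x ∈ integralH1 (tateRep (c389a1.e.baseChange ℚ) 5) 5 ⊤ ∧ t ≠ 0 ∧
          HasLocPKummerLog (c389a1.e.baseChange ℚ) 5 x t)) →
      ∀ (K : ZpExtension ℚ 5) (hK : K.IsCyclotomic) (γ : Field.absoluteGaloisGroup ℚ)
        (I : IwasawaH1Data (c389a1.e.baseChange ℚ) 5 K γ) (z₀ : I.H), K.IsTopGenerator γ →
        IsAdmissibleZetaClass (c389a1.e.baseChange ℚ) 5 K hK I z₀ →
        ¬ ∃ (h : I.H) (m : ℕ), ((5 : IwasawaAlgebra 5) ^ m) • z₀ =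
          ((PowerSeries.X : IwasawaAlgebra 5) ^ 2) • h)
    (hall : ∀ {N : ℕ} [NeZero N] (f : CuspForm (Gamma0 N) 2), IsNewformOf (c389a1.e.baseChange ℚ) f →
        (padicLFunction f (unitRoot (c389a1.e.baseChange ℚ) 5 : ℚ_[5])).order ≤ 2) :
    (5 ≤ 5 ∧ IsOrdinaryAt (c389a1.e.baseChange ℚ) 5 ∧
        (c389a1.e.baseChange ℚ).HasSurjectiveModNGaloisRep 5) →
      ∀ {N : ℕ} [NeZero N] (f : CuspForm (Gamma0 N) 2), IsNewformOf (c389a1.e.baseChange ℚ) f →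
        (padicLFunction f (unitRoot (c389a1.e.baseChange ℚ) 5 : ℚ_[5])).order ≤ 2 →
        (∃ (x : H1 (tateRep (c389a1.e.baseChange ℚ) 5) ⊤) (t : ℚ_[5]),
          x ∈ integralH1 (tateRep (c389a1.e.baseChange ℚ) 5) 5 ⊤ ∧ t ≠ 0 ∧
          HasLocPKummerLog (c389a1.e.baseChange ℚ) 5 x t) →
      ∀ (K : ZpExtension ℚ 5) (hK : K.IsCyclotomic) (γ : Field.absoluteGaloisGroup ℚ)
        (I : IwasawaH1Data (c389a1.e.baseChange ℚ) 5 K γ) (z₀ : I.H), K.IsTopGenerator γ →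
        IsAdmissibleZetaClass (c389a1.e.baseChange ℚ) 5 K hK I z₀ →
        ¬ ∃ (h : I.H) (m : ℕ), ((5 : IwasawaAlgebra 5) ^ m) • z₀ =
          ((PowerSeries.X : IwasawaAlgebra 5) ^ 2) • h :=
  fun hdoor _ _ _ _ _ hLoc => hSand hdoor ⟨hall, hLoc⟩

end Summit.BirchSwinnertonDyer.BirchSwinnertonDyer.Theorems.DerivedKatoValuationDoor

end
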